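/-
Copyright: the b2b-balaban T⁴-continuum CRUX team, row NE7b, leaf lineage `t4-ne7b-formalise-leaf-02` (gen 133). Project licence.
-/
import Literature.MathematicalPhysics.QuantumFieldTheory.Balaban1983to89.B7AvgGaugeCovariance
import Literature.MathematicalPhysics.QuantumFieldTheory.Balaban1983to89.B7Eq47AveragedBondVsStraight
import Mathlib.Tactic.Linarith
import Mathlib.Tactic.Positivity

/-!
# READING R-V AT ONE STEP, BY VALUE: in the axial gauge of [B7] p. 24 based at `y₀`, under (44) `‖V₀(∂p) − 1‖ ≤ α₀` and `512(d+1)(d+4)L²α₀ ≤ 1`,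
# every bond variable satisfies `‖V₀^{g}(x,μ) − 1‖ ≤ |x − y₀|₁·α₀`, every straight `L`-segment `‖V₀^{g}([q, q + Le_κ]) − 1‖ ≤ L(|q − y₀|₁ + L)·α₀`,
# and every block-averaged bond variable `‖\overline{(V₀^{g})}(c) − 1‖ ≤ (64(d+1)(d+4)L² + L(|q − y₀|₁ + L))·α₀` — the transports' size `τ` of
# `…CoarseCurlTransportLetters` DISCHARGED LOCALLY (row NE7b, node U5c; `HOME/b2b-balaban-r1/SectE-interface-proof.md` §1 «R-V: on every
# `M`-cube of the unit lattice a gauge with `|V − 1| ≤ ε_F` (from (π4) at `j = k` and gauge covariance of the averaging, B7 (29)∕B9 (3.29), plus B7 Prop. 1)»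
# and §5.5 Lemma 5.5; E-side key reading — the (h2) skeleton's `η = 8ε_F` letter gets its `ε_F` at `k = 1`: `τ(R) = (64(d+1)(d+4)L² + L(R + L))·α₀` on the
# coarse bonds within `ℓ¹`-distance `R` of the gauge's base point)

Cell `pub-balaban`, sub-cell `t4`, spine estimate NE7b (`T4WeightBudget.RelWeightBound`; the cell's OWN estimate — NOT PRINTED in
[Bałaban 1983–89], NOT PROVED).  Crux-route work under `Spine/NE7b/` by the row's E-side ∕ key-readings ∕ lattice-geometry leaf lineage; [folklore]
letters BY NAME over three Literature modules with hub oleans: `B7Prop1Explicit.axial_bond_bound` ([B7] p. 25 l. 3 «for `b ⊂ Δ(p′)` we have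
`|V₀,b − 1| < |b₋ − y|α₀`» — Prop. 1's bond bound in the axial gauge `axialFn V y`), `B7AvgGaugeCovariance.norm_hol_gaugeAct_plaqWord` ((45): (44) is gauge
invariant), `B7Eq47AveragedBondVsStraight.norm_bavg_sub_straight_le_of_pdev` (`‖V̄(c) − V([c])‖ ≤ 64(d+1)(d+4)L²α₀` under (44)); NOTHING of Bałaban's is
asserted beyond what those modules prove; no `T4Continuum/Support` leaf typed; no `def`, no notation, no instance; zero `sorry`.

WHAT IS PROVED ([folklore]; `V₀` unit-ball valued on `ℤ^d`, `g := axialFn V₀ y₀`, `V₀^g := gaugeAct g V₀`):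
* §1 (private `norm_mul_sub_one_le`), `norm_hol_seg_sub_one_le` — a straight segment of `n` unit-ball bond variables each within `δ_t` of `1` is within `Σ_t δ_t` of `1` (telescoping,
  `hol_seg_natCast_succ`); `l1_add_natMul_e_le` (`|q + te_κ − y₀|₁ ≤ |q − y₀|₁ + t`).
* §2 **`norm_axial_seg_sub_one_le`** — `‖V₀^g([q, q + Le_κ]) − 1‖ ≤ L·(|q − y₀|₁ + L)·α₀` (`axial_bond_bound` per bond + §1).
* §3 `h44_gaugeAct` ((44) for `V₀^g`, by (45)), **`norm_bavg_axial_sub_one_le`** — THE LETTER: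
  `‖\overline{(V₀^g)}(⟨q, q + Le_κ⟩) − 1‖ ≤ 64(d+1)(d+4)L²α₀ + L(|q − y₀|₁ + L)α₀`; **`norm_bavg_axial_sub_one_le_of_l1_le`** — on the coarse bonds with
  `|q − y₀|₁ ≤ R`: `≤ (64(d+1)(d+4)L² + L(R + L))·α₀ =: τ(R)` — the `τ` of `…CoarseCurlTransportLetters.abs_X_sub_X1_le` on a cube of `ℓ¹`-radius `R`
  about the base point, so `η = 8τ(R)` there.

HONEST SHAPE ∕ BY VALUE.  For the IMS cubes of the memo (side `2M_loc` coarse blocks, fine `ℓ¹`-radius `R ≲ 2dM_locL` from a corner base point):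
`τ ≲ (64(d+1)(d+4)L² + 2dM_locL² + L²)α₀ = O((d² + dM_loc)L²α₀)` — print's `ε_F = O(1)Mα₀` scaled by the one-step block (`L²` in lattice units; the fine
spacing is `η = L⁻¹`).  At `d = 4`, `L = 2`, `M_loc = 8` (chair leaf-04 g159's re-computation, δ-X-LGTS-1): `τ ≤ (10240 + 256 + 4)α₀ = 10500α₀`,
`η = 8τ ≤ 84000α₀`; at the smallness edge `α₀ = 1∕81920` the first term is EXACTLY `1∕8` (by `hsmall`), so `τ ≤ 0.128` and `η ≤ 1.03` — the
letter is `O(1)` at the edge of (44)'s regime and small (`η ≤ 0.28`) only for `α₀ ≲ 1∕300000`.  NEAREST TREE LETTERS (ι-X-LGTS-1): §1's telescope ~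
`B8Lemma1NonAbelian.seg_walk`; §2 has a SHARP box-local twin `B8Lemma1NonAbelian.norm_axial_seg_sub_one_le` (`n·|lowPart κ r|₁·a` under `PlaqSmall`
— by it the `+ L` slack here is removable); `norm_mul_sub_one_le` ~ `B8Ineq170.norm_mul_sub_one_le_of_norm_le_one` ∕ `B11V0Interface.norm_mul_sub_one_le`
(the `‖a‖ ≤ 1` currency) — different binders; §3 has no tree twin.  NOT HERE: the choice of base points ∕ cubes off the torus seam (the consumer's, with `…CoarseCurlTransportLetters.X_gaugeAct_eq_of_noWrap`),
the IMS error and Lemma 2.4′ (leaf-05's `…AdmissibleFloor*`, `…IMSErrorLetters`), `k > 1` ((π4) at `j = k`: [B9] (3.35)–(3.36) for `Ū^k` — B7 Props 1–2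
through the levels, `B7AvgGaugeCovariance.avgIter_gaugeAct`), anything of Bałaban's ((A3) ∕ (A1c), NC-NE7b-α UNRULED).  BY-NAME EFFECT ON THE WALL: NONE (the
(h2) slot's `ε_F` at `k = 1`; the wall is (R2)).  NE7b NOT PRINTED ∕ NOT PROVED; spine PROVED 0∕9; rung (B)+1 on a FINITE torus — NOT infinite volume, NOT
the mass gap, NOT Clay.
HONEST DEPENDENCY: continuum YM on T⁴ ⇐ BetaPertH ∧ nine spine estimates (0/9 proved); BetaPertH ⇐ (D1) ∧ (D4) ∧ CAP+tail; G-an2-4 gates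
asym, D1 and NE2/3/4.
-/

set_option autoImplicit false

noncomputable section

open scoped BigOperators
open Finset
open Literature.MathematicalPhysics.QuantumFieldTheory.Balaban1983to89
open Literature.MathematicalPhysics.QuantumFieldTheory.Balaban1983to89.B7Prop1Explicit (Site e hol seg bavg plaqWord U1 gaugeAct axialFn l1
  hol_seg_natCast_succ seg_natCast hol_nil l1_add_le l1_zsmul_e axial_bond_bound gaugeAct_mem axialFn_mem mem_U1)

namespace Summit.QuantumFields.BalabanUV.T4Continuum.NE7b.LocalGaugeTransportSize

variable {d : ℕ}
variable {𝔸 : Type*} [NormedRing 𝔸] [NormedAlgebra ℂ 𝔸] [NormOneClass 𝔸] [CompleteSpace 𝔸]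

/-! ## §1 Straight segments of near-unit bond variables -/

section Segments

omit [NormedAlgebra ℂ 𝔸] [CompleteSpace 𝔸] in
/-- `‖uv − 1‖ ≤ ‖u − 1‖ + ‖v − 1‖` for `u` in the unit-ball class (`private`: the `U1`-currency twin of `B11V0Interface.norm_mul_sub_one_le`;
`…CoarseCurlTransportLetters` carries the same private copy). [folklore] -/
private theorem norm_mul_sub_one_le {u : 𝔸ˣ} (hu : u ∈ U1 𝔸) (v : 𝔸ˣ) :
    ‖((u * v : 𝔸ˣ) : 𝔸) - 1‖ ≤ ‖(u : 𝔸) - 1‖ + ‖(v : 𝔸) - 1‖ := by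
  have h1 := (mem_U1.1 hu).1
  have hsplit : ((u * v : 𝔸ˣ) : 𝔸) - 1 = (u : 𝔸) * ((v : 𝔸) - 1) + ((u : 𝔸) - 1) := by
    rw [Units.val_mul]; noncomm_ring
  rw [hsplit]
  refine (norm_add_le _ _).trans ?_
  have h2 : ‖(u : 𝔸) * ((v : 𝔸) - 1)‖ ≤ ‖(v : 𝔸) - 1‖ :=
    (norm_mul_le _ _).trans (by nlinarith [norm_nonneg ((v : 𝔸) - 1)])
  linarith

omit [NormedAlgebra ℂ 𝔸] [CompleteSpace 𝔸] in
/-- **A STRAIGHT SEGMENT OF NEAR-UNIT BOND VARIABLES IS NEAR `1`**: `‖V(z + te_κ, κ) − 1‖ ≤ δ t` for `t < n`, `V` unit-ball valued ⊢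
`‖V([z, z + ne_κ]) − 1‖ ≤ Σ_{t<n} δ t`. [folklore] -/
theorem norm_hol_seg_sub_one_le {V : Site d → Fin d → 𝔸ˣ} (hV : ∀ x κ, V x κ ∈ U1 𝔸) (z : Site d) (κ : Fin d) (δ : ℕ → ℝ) :
    ∀ n : ℕ, (∀ t < n, ‖((V (z + (t : ℤ) • e κ) κ : 𝔸ˣ) : 𝔸) - 1‖ ≤ δ t) →
      ‖((hol V z (seg κ (n : ℤ)) : 𝔸ˣ) : 𝔸) - 1‖ ≤ ∑ t ∈ Finset.range n, δ t
  | 0, _ => by simp [hol_nil]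
  | n + 1, h => by
    rw [Nat.cast_succ, hol_seg_natCast_succ, Finset.sum_range_succ]
    have ih := norm_hol_seg_sub_one_le hV z κ δ n fun t ht => h t (Nat.lt_succ_of_lt ht)
    have hmem : hol V z (seg κ (n : ℤ)) ∈ U1 𝔸 := B7Prop1Explicit.hol_mem hV _ _
    have hlast := h n (Nat.lt_succ_self n)
    exact (norm_mul_sub_one_le hmem _).trans (add_le_add ih hlast)

/-- `|q + te_κ − y₀|₁ ≤ |q − y₀|₁ + t`. [folklore] -/
theorem l1_add_natMul_e_le (q y₀ : Site d) (κ : Fin d) (t : ℕ) : l1 (q + (t : ℤ) • e κ - y₀) ≤ l1 (q - y₀) + t := by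
  have h : q + (t : ℤ) • e κ - y₀ = (q - y₀) + (t : ℤ) • e κ := by abel
  rw [h]
  refine (l1_add_le _ _).trans ?_
  rw [l1_zsmul_e, Int.natAbs_natCast]

end Segments

/-! ## §2 The axial gauge: bonds and straight segments -/

section Axial

variable (L : ℕ) {V₀ : Site d → Fin d → 𝔸ˣ} (hV₀ : ∀ x κ, V₀ x κ ∈ U1 𝔸) (y₀ : Site d) {α₀ : ℝ} (hα₀ : 0 ≤ α₀)
  (h44 : ∀ (x : Site d) (κ κ' : Fin d), κ ≠ κ' → ‖((hol V₀ x (plaqWord κ κ') : 𝔸ˣ) : 𝔸) - 1‖ ≤ α₀)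

include hV₀ hα₀ h44 in
omit [NormedAlgebra ℂ 𝔸] [CompleteSpace 𝔸] in
/-- **A STRAIGHT `L`-SEGMENT IN THE AXIAL GAUGE**: `‖V₀^g([q, q + Le_κ]) − 1‖ ≤ L·(|q − y₀|₁ + L)·α₀`, `g = axialFn V₀ y₀` — each of the `L` bonds is within
`|b₋ − y₀|₁α₀ ≤ (|q − y₀|₁ + t)α₀` of `1` (`B7Prop1Explicit.axial_bond_bound` BY NAME). [folklore] -/
theorem norm_axial_seg_sub_one_le (q : Site d) (κ : Fin d) :
    ‖((hol (gaugeAct (axialFn V₀ y₀) V₀) q (seg κ (L : ℤ)) : 𝔸ˣ) : 𝔸) - 1‖ ≤ (L : ℝ) * ((l1 (q - y₀) : ℝ) + L) * α₀ := by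
  have hVg : ∀ x κ, gaugeAct (axialFn V₀ y₀) V₀ x κ ∈ U1 𝔸 := gaugeAct_mem hV₀ (axialFn_mem hV₀ y₀)
  have hb : ∀ t < L, ‖((gaugeAct (axialFn V₀ y₀) V₀ (q + (t : ℤ) • e κ) κ : 𝔸ˣ) : 𝔸) - 1‖ ≤ ((l1 (q - y₀) : ℝ) + L) * α₀ := by
    intro t ht
    refine (axial_bond_bound V₀ hV₀ y₀ h44 hα₀ (q + (t : ℤ) • e κ) κ).trans ?_
    refine mul_le_mul_of_nonneg_right ?_ hα₀
    have h := l1_add_natMul_e_le q y₀ κ t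
    have : (l1 (q + (t : ℤ) • e κ - y₀) : ℝ) ≤ (l1 (q - y₀) : ℝ) + t := by exact_mod_cast h
    have ht' : (t : ℝ) ≤ L := by exact_mod_cast ht.le
    linarith
  refine (norm_hol_seg_sub_one_le hVg q κ (fun _ => ((l1 (q - y₀) : ℝ) + L) * α₀) L hb).trans (le_of_eq ?_)
  rw [Finset.sum_const, Finset.card_range, nsmul_eq_mul]
  ring

end Axial

/-! ## §3 The block-averaged bond variables in the axial gauge: the letter `τ` -/

section Averaged

variable (L : ℕ) (hL : 1 ≤ L) {V₀ : Site d → Fin d → 𝔸ˣ} (hV₀ : ∀ x κ, V₀ x κ ∈ U1 𝔸) (y₀ : Site d) {α₀ : ℝ} (hα₀ : 0 ≤ α₀)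
  (hsmall : 512 * (d + 1) * (d + 4) * (L : ℝ) ^ 2 * α₀ ≤ 1)
  (h44 : ∀ (x : Site d) (κ κ' : Fin d), κ ≠ κ' → ‖((hol V₀ x (plaqWord κ κ') : 𝔸ˣ) : 𝔸) - 1‖ ≤ α₀)

include h44 in
omit [NormedAlgebra ℂ 𝔸] [CompleteSpace 𝔸] in
/-- **(44) IS GAUGE INVARIANT** ((45), `B7AvgGaugeCovariance.norm_hol_gaugeAct_plaqWord`): the axial-gauged configuration satisfies (44) with the same `α₀`.
[folklore] -/
theorem h44_gaugeAct {u : Site d → 𝔸ˣ} (hu : ∀ x, u x ∈ U1 𝔸) :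
    ∀ (x : Site d) (κ κ' : Fin d), κ ≠ κ' → ‖((hol (gaugeAct u V₀) x (plaqWord κ κ') : 𝔸ˣ) : 𝔸) - 1‖ ≤ α₀ := fun x κ κ' hκ => by
  rw [B7AvgGaugeCovariance.norm_hol_gaugeAct_plaqWord hu]
  exact h44 x κ κ' hκ

include hL hV₀ hα₀ hsmall h44 in
/-- **THE LETTER `τ` AT ONE COARSE BOND**: in the axial gauge based at `y₀`,
`‖\overline{(V₀^g)}(⟨q, q + Le_κ⟩) − 1‖ ≤ 64(d+1)(d+4)L²α₀ + L(|q − y₀|₁ + L)α₀` (`norm_bavg_sub_straight_le_of_pdev` for `V₀^g` + §2). [folklore] -/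
theorem norm_bavg_axial_sub_one_le (q : Site d) (κ : Fin d) :
    ‖((bavg L (gaugeAct (axialFn V₀ y₀) V₀) q κ : 𝔸ˣ) : 𝔸) - 1‖
      ≤ 64 * (d + 1) * (d + 4) * (L : ℝ) ^ 2 * α₀ + (L : ℝ) * ((l1 (q - y₀) : ℝ) + L) * α₀ := by
  have hVg : ∀ x κ, gaugeAct (axialFn V₀ y₀) V₀ x κ ∈ U1 𝔸 := gaugeAct_mem hV₀ (axialFn_mem hV₀ y₀)
  have h44g := h44_gaugeAct (α₀ := α₀) h44 (axialFn_mem hV₀ y₀)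
  have h1 := B7Eq47AveragedBondVsStraight.norm_bavg_sub_straight_le_of_pdev L hL hVg hα₀ hsmall h44g q κ
  have h2 := norm_axial_seg_sub_one_le L hV₀ y₀ hα₀ h44 q κ
  have hsplit : ((bavg L (gaugeAct (axialFn V₀ y₀) V₀) q κ : 𝔸ˣ) : 𝔸) - 1
      = (((bavg L (gaugeAct (axialFn V₀ y₀) V₀) q κ : 𝔸ˣ) : 𝔸) - ((hol (gaugeAct (axialFn V₀ y₀) V₀) q (seg κ (L : ℤ)) : 𝔸ˣ) : 𝔸))
        + (((hol (gaugeAct (axialFn V₀ y₀) V₀) q (seg κ (L : ℤ)) : 𝔸ˣ) : 𝔸) - 1) := by abel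
  rw [hsplit]
  exact (norm_add_le _ _).trans (add_le_add h1 h2)

include hL hV₀ hα₀ hsmall h44 in
/-- **THE LETTER `τ(R)` ON A CUBE**: for the coarse bonds whose base point is within `ℓ¹`-distance `R` of `y₀`,
`‖\overline{(V₀^g)}(c) − 1‖ ≤ (64(d+1)(d+4)L² + L(R + L))·α₀` — the `τ` of `…CoarseCurlTransportLetters.abs_X_sub_X1_le` (`η = 8τ(R)`), reading R-V at
`k = 1` by value. [folklore] -/
theorem norm_bavg_axial_sub_one_le_of_l1_le {R : ℕ} (q : Site d) (hq : l1 (q - y₀) ≤ R) (κ : Fin d) :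
    ‖((bavg L (gaugeAct (axialFn V₀ y₀) V₀) q κ : 𝔸ˣ) : 𝔸) - 1‖
      ≤ (64 * (d + 1) * (d + 4) * (L : ℝ) ^ 2 + (L : ℝ) * ((R : ℝ) + L)) * α₀ := by
  have h := norm_bavg_axial_sub_one_le L hL hV₀ y₀ hα₀ hsmall h44 q κ
  have hR : (l1 (q - y₀) : ℝ) ≤ R := by exact_mod_cast hq
  have hL0 : (0 : ℝ) ≤ L := by positivity
  nlinarith [mul_nonneg (mul_nonneg hL0 (sub_nonneg.2 hR)) hα₀]

end Averaged

end Summit.QuantumFields.BalabanUV.T4Continuum.NE7b.LocalGaugeTransportSize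

end
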